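import Summits.QuantumFields.YangMills.Theorems.UnitScaleTiltProp7GaugeSliceDecomposition
import HarnessLib

/-!
# Route `UnitScaleTilt`, crux K1 child «MinimiserStabilityRegPr» (stmt-QuantumFields-19200), skeleton v10, stub `stub_existenceMinimalOrbit` (EX), route (α) —
# **THE RESTRICTED LANDAU DIVERGENCE `R_S(U₀)D*_{U₀}` AND THE COVARIANT LAPLACIAN `Δ^η_{U₀}` RESPECT THE THREE SECTORS `M₂(ℂ) = 𝔰𝔲(2) ⊕ i·𝔰𝔲(2) ⊕ ℂ·1`**:
# `R_S D*` maps `𝔰𝔲(2)`-valued vector fields to `𝔰𝔲(2)`-valued gauge parameters and central (scalar) vector fields to central gauge parameters; `Δ^η` maps `𝔰𝔲(2)`-valued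
# parameters to `𝔰𝔲(2)`-valued parameters — the rows `hLsu`, `hLsc`, `hΔsu` of ★w5-20520 g7's ✓`Prop7LandauTransversalityMargin.hcore_su2_of_pairing` (R2-M-su2), given only the
# three displayed reality rows of the averaging `QTwS U₀` (`hQ` star, `hQtr` traceless, `hQsc` scalar), and BY NAME at `U₀ ∈ 𝔘_k(ε₀)`.

Cell `ym3-torus`, width seat `ym-ust-20520-w4` (gen 7).  THEOREMS ONLY (0 `def`, 0 `sorry`).  Part 1∕2 of the chart-level discharge «(R2-M-su2-chart)» named by ★w5-20520 g7
(bus 2026-08-28 18:35:27Z (2)); `--supports stmt-QuantumFields-19200 --as helper`, count-neutral.  YM₃ on T³ is a ladder rung (R3), not the Clay problem; nothing here claims the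
stub, the crux, d = 4 or the mass gap.

THE PRINT.  [Balaban1985BackgroundPropagators] p. 393 «the operators … are real», (3.8) `D*`, (3.20)–(3.23) `R` = orthogonal projection onto `Δ^η_U N(Q′)`; [Balaban1985Variational]
(51) p. 286 «for A′ with values in 𝔤 the configuration D(A′) has values in 𝔤 also».  «Real» has two halves on `M₂(ℂ)`-valued fields: commuting with the anti-unitary conjugation
`X ↦ X⋆` (skew-Hermitian sector) and respecting the orthogonal splitting «traceless ⊕ scalar» (unitary reflection of the traceless sector).  Both halves are inherited by `D* = D†`
and by the projector `R_S` from their data `D_{U₀}`, `Q(U₀)` — this is EXACTLY the engine of ✓`Prop7GaugeSliceDecomposition.exists_slice_add_gaugeDir_skew` (★w4-20520 g5, this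
lineage), whose involution triples are rebuilt here inside the proof (def-free) and read on the OUTPUT side of `R_S D*` instead of on the gauge parameter `λ₀`.

WHAT IS PROVED (member `F`, `h : n ≤ K`, weights `c₀ cB`; sorry-free, no definition; ns `…Theorems.Prop7LandauDivergenceSectors`):
* §1 ★★`RSPi_DstarPi_sectors (hQ hQtr hQsc)` — BOTH sector rows of `R_S(U₀)D*_{U₀}` read on the route carriers (`RSPi U₀ ∘ DstarPi U₀`): (a) `Y` skew-Hermitian traceless ⟹
  `RSPi U₀ (DstarPi U₀ Y)` skew-Hermitian traceless; (b) `Y` central (`Y b = z_b·1`) ⟹ `RSPi U₀ (DstarPi U₀ Y)` central.  Corollaries `RSPi_DstarPi_su2`, `RSPi_DstarPi_central`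
  (the shapes `hLsu`, `hLsc` VERBATIM) and `…_of_regPr` (the `QTwS` rows BY NAME: ✓`QTwS_star_comm_of_regPr`∕`QTwS_traceless_of_regPr`∕`QTwS_scalar_of_regPr`).
* §2 ★`covLapSite_su2` — `toL2S⁻¹(Δ^η_{U₀}(toL2S l))` is skew-Hermitian traceless for skew-Hermitian traceless `l` (no `QTwS` row: ✓`covLapSite_star_comm` + the trace stencils
  ✓`trace_DL2_apply_eq_zero`∕✓`trace_DstarL2_apply_eq_zero`) — the shape `hΔsu` VERBATIM.
HONEST SCOPE.  Finite-dimensional Hilbert-space bookkeeping over landed letters (p03 ∕ ★w4 g4–g5 reality files); no estimate; nothing of print asserted beyond the cited definitions;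
no stub ∕ crux statement is advanced.

References: T. Bałaban, CMP 99 (1985) 389–434 [Balaban1985BackgroundPropagators] ((3.3) p.391, (3.8) p.392, p.393, (3.20)–(3.23) p.394, (3.115) p.418); CMP 102 (1985) 277–309
[Balaban1985Variational] ((45) p.285, (51) p.286).
-/

set_option autoImplicit false

noncomputable section

open scoped InnerProductSpace ComplexConjugate Matrix.Norms.L2Operator

namespace Summit.QuantumFields.YangMills.Theorems.Prop7LandauDivergenceSectors

open Literature.MathematicalPhysics.QuantumFieldTheory.Balaban1983to89
open Literature.MathematicalPhysics.QuantumFieldTheory.Balaban1983to89.T3ContinuumYM3Torus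
open T3PrintedRegularMinimiser (RegPr)
open B9Eq311L2Pairing (WL2)
open B11Eq103H1Complex (SiteL2K BondL2K)
open Summit.QuantumFields.YangMills.Theorems.Prop7SectET3Transport (periodsT3)
open Summit.QuantumFields.YangMills.Theorems.Prop7SectET3HilbertLetters (W₂ toL2 toL2S toL2B QL2 DL2 DstarL2 covLapSite QL2_toL2 inner_toL2 inner_toL2B adjoint_DL2)
open Summit.QuantumFields.YangMills.Theorems.Prop7SectET3RealCoordSums (inner_toL2S)
open Summit.QuantumFields.YangMills.Theorems.Prop7SymAvgTwSym (QTwS QTwS_star_comm_of_regPr QTwS_scalar_of_regPr QTwS_traceless_of_regPr)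
open Summit.QuantumFields.YangMills.Theorems.Prop7SectET3GaugeProjector (QDS NS RS RSPi DstarPi RSPi_apply DstarPi_apply)
open Summit.QuantumFields.YangMills.Theorems.Prop7SectET3PropagatorsReality (map_zero_of_map_add map_sub_of_map_add DstarL2_comm' QDS_comm RS_comm covLapSite_comm)
open Summit.QuantumFields.YangMills.Theorems.Prop7SectET3HilbertLettersReality (toL2_star_star toL2_star_add toL2_star_smul_real inner_toL2_star toL2S_star_star toL2S_star_add
  toL2S_star_smul_real inner_toL2S_star toL2B_star_star toL2B_star_add toL2B_star_smul_real inner_toL2B_star DL2_star_comm QL2_star_comm_of DstarL2_star_comm covLapSite_star_comm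
  trace_DL2_apply_eq_zero)
open Summit.QuantumFields.YangMills.Theorems.Prop7H46RealityTrace (reflection_comm_of_mapsTo mapsTo_orthogonal_of_adjoint exists_smul_one_of_trace_orthogonal trace_conjTranspose_mul_smul_one
  trace_DstarL2_apply_eq_zero)

variable (F : T3Family) {n K : ℕ} (h : n ≤ K) {c₀ cB : ℝ} [Fact (0 < c₀)] [Fact (0 < cB)]

/-! ## §1 The two sector rows of the restricted Landau divergence `R_S(U₀)D*_{U₀}` -/

/-- ★★ **THE RESTRICTED LANDAU DIVERGENCE RESPECTS THE THREE SECTORS.**  At any background `U₀` whose averaging `QTwS U₀` is real (`hQ`) and respects the traceless ∕ scalar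
sectors (`hQtr`∕`hQsc`): (a) for every skew-Hermitian traceless vector field `Y`, `RSPi U₀ (DstarPi U₀ Y)` is skew-Hermitian traceless; (b) for every central vector field `Y`
(`Y b = z_b·1`), `RSPi U₀ (DstarPi U₀ Y)` is central.  Proof: `D* = D†` and `R_S = proj_{Δ^η N_S}` commute with the conjugation triple (✓`DstarL2_star_comm`, ✓`RS_comm` at the
anti-unitary kind) and with the reflection triple of the traceless sectors (✓`DstarL2_comm'`, ✓`RS_comm` at the unitary kind; the data rows ✓`trace_DL2_apply_eq_zero`,
✓`trace_DstarL2_apply_eq_zero`, `hQtr`, `hQsc`); a field is traceless iff fixed by the reflection, central iff anti-fixed (`(𝔰𝔩₂)^⊥ = ℂ·1`, ✓`exists_smul_one_of_trace_orthogonal`).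
[cite: Balaban1985BackgroundPropagators, (3.8) p.392, p.393, (3.20)–(3.23) p.394; Balaban1985Variational, (51) p.286] -/
theorem RSPi_DstarPi_sectors (U₀ : GaugeField (F.P K) 0 (Matrix.specialUnitaryGroup (Fin 2) ℂ))
    (hQ : ∀ A : PBond (F.P K) 0 → Matrix (Fin 2) (Fin 2) ℂ, QTwS F n K h U₀ (star A) = star (QTwS F n K h U₀ A))
    (hQtr : ∀ A : PBond (F.P K) 0 → Matrix (Fin 2) (Fin 2) ℂ, (∀ b, (A b).trace = 0) → ∀ c, (QTwS F n K h U₀ A c).trace = 0)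
    (hQsc : ∀ c : PBond (F.P K) 0 → ℂ, ∃ d : PBond (F.P n) 0 → ℂ, QTwS F n K h U₀ (fun b => c b • (1 : Matrix (Fin 2) (Fin 2) ℂ)) = fun c' => d c' • 1) :
    (∀ Y : PBond (F.P K) 0 → Matrix (Fin 2) (Fin 2) ℂ, (∀ b, star (Y b) = -Y b ∧ (Y b).trace = 0) →
      ∀ x, star (RSPi F n K h c₀ cB U₀ (DstarPi F n K c₀ U₀ Y) x) = -RSPi F n K h c₀ cB U₀ (DstarPi F n K c₀ U₀ Y) x ∧
        (RSPi F n K h c₀ cB U₀ (DstarPi F n K c₀ U₀ Y) x).trace = 0) ∧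
    (∀ Y : PBond (F.P K) 0 → Matrix (Fin 2) (Fin 2) ℂ, (∀ b, ∃ z : ℂ, Y b = z • (1 : Matrix (Fin 2) (Fin 2) ℂ)) →
      ∀ x, ∃ z : ℂ, RSPi F n K h c₀ cB U₀ (DstarPi F n K c₀ U₀ Y) x = z • (1 : Matrix (Fin 2) (Fin 2) ℂ)) := by
  ------------------------------------------------------------------
  -- (R) the conjugation triple `cE`, `cS`, `cF`
  ------------------------------------------------------------------
  set cE : BondL2K ℂ 3 (periodsT3 F K) c₀ W₂ → BondL2K ℂ 3 (periodsT3 F K) c₀ W₂ := fun f => toL2 F K c₀ (star ((toL2 F K c₀).symm f)) with hcE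
  set cS : SiteL2K ℂ 3 (periodsT3 F K) c₀ W₂ → SiteL2K ℂ 3 (periodsT3 F K) c₀ W₂ := fun g => toL2S F K c₀ (star ((toL2S F K c₀).symm g)) with hcS
  set cF : WL2 ℂ (fun _ : PBond (F.P n) 0 => cB) W₂ → WL2 ℂ (fun _ : PBond (F.P n) 0 => cB) W₂ := fun y => toL2B F n cB (star ((toL2B F n cB).symm y)) with hcF
  have hkindc : ((∀ x y : BondL2K ℂ 3 (periodsT3 F K) c₀ W₂, ⟪cE x, cE y⟫_ℂ = ⟪y, x⟫_ℂ) ∧ (∀ x y : SiteL2K ℂ 3 (periodsT3 F K) c₀ W₂, ⟪cS x, cS y⟫_ℂ = ⟪y, x⟫_ℂ) ∧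
      (∀ x y : WL2 ℂ (fun _ : PBond (F.P n) 0 => cB) W₂, ⟪cF x, cF y⟫_ℂ = ⟪y, x⟫_ℂ)) ∨
    ((∀ x y : BondL2K ℂ 3 (periodsT3 F K) c₀ W₂, ⟪cE x, cE y⟫_ℂ = ⟪x, y⟫_ℂ) ∧ (∀ x y : SiteL2K ℂ 3 (periodsT3 F K) c₀ W₂, ⟪cS x, cS y⟫_ℂ = ⟪x, y⟫_ℂ) ∧
      (∀ x y : WL2 ℂ (fun _ : PBond (F.P n) 0 => cB) W₂, ⟪cF x, cF y⟫_ℂ = ⟪x, y⟫_ℂ)) := Or.inl ⟨inner_toL2_star, inner_toL2S_star, inner_toL2B_star⟩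
  have hDc : ∀ g, DL2 F n K c₀ U₀ (cS g) = cE (DL2 F n K c₀ U₀ g) := DL2_star_comm U₀
  have hQc : ∀ f, QL2 F n K h c₀ cB U₀ (cE f) = cF (QL2 F n K h c₀ cB U₀ f) := QL2_star_comm_of U₀ hQ
  have hDsc : ∀ f, DstarL2 F n K c₀ U₀ (cE f) = cS (DstarL2 F n K c₀ U₀ f) := DstarL2_star_comm (n := n) U₀
  have hRSc : ∀ g, RS F n K h c₀ cB U₀ (cS g) = cS (RS F n K h c₀ cB U₀ g) :=
    RS_comm F n K h c₀ cB U₀ cE cS cF hkindc toL2S_star_add toL2B_star_add toL2_star_star toL2S_star_star hDc hQc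
  ------------------------------------------------------------------
  -- (T) the reflection triple of the traceless sectors
  ------------------------------------------------------------------
  let VE : Submodule ℂ (BondL2K ℂ 3 (periodsT3 F K) c₀ W₂) :=
    { carrier := {f | ∀ b, ((toL2 F K c₀).symm f b).trace = 0}
      add_mem' := fun {f g} hf hg b => by rw [map_add, Pi.add_apply, Matrix.trace_add, hf b, hg b, add_zero]
      zero_mem' := fun b => by rw [map_zero, Pi.zero_apply, Matrix.trace_zero]
      smul_mem' := fun r f hf b => by rw [map_smul, Pi.smul_apply, Matrix.trace_smul, hf b, smul_zero] }
  let VS : Submodule ℂ (SiteL2K ℂ 3 (periodsT3 F K) c₀ W₂) :=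
    { carrier := {g | ∀ x, ((toL2S F K c₀).symm g x).trace = 0}
      add_mem' := fun {f g} hf hg x => by rw [map_add, Pi.add_apply, Matrix.trace_add, hf x, hg x, add_zero]
      zero_mem' := fun x => by rw [map_zero, Pi.zero_apply, Matrix.trace_zero]
      smul_mem' := fun r f hf x => by rw [map_smul, Pi.smul_apply, Matrix.trace_smul, hf x, smul_zero] }
  let VF : Submodule ℂ (WL2 ℂ (fun _ : PBond (F.P n) 0 => cB) W₂) :=
    { carrier := {y | ∀ c, ((toL2B F n cB).symm y c).trace = 0}
      add_mem' := fun {f g} hf hg c => by rw [map_add, Pi.add_apply, Matrix.trace_add, hf c, hg c, add_zero]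
      zero_mem' := fun c => by rw [map_zero, Pi.zero_apply, Matrix.trace_zero]
      smul_mem' := fun r f hf c => by rw [map_smul, Pi.smul_apply, Matrix.trace_smul, hf c, smul_zero] }
  haveI : CompleteSpace VE := FiniteDimensional.complete ℂ VE
  haveI : CompleteSpace VS := FiniteDimensional.complete ℂ VS
  haveI : CompleteSpace VF := FiniteDimensional.complete ℂ VF
  have memVE : ∀ A : PBond (F.P K) 0 → Matrix (Fin 2) (Fin 2) ℂ, toL2 F K c₀ A ∈ VE ↔ ∀ b, (A b).trace = 0 := fun A => by
    change (∀ b, ((toL2 F K c₀).symm (toL2 F K c₀ A) b).trace = 0) ↔ _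
    rw [LinearEquiv.symm_apply_apply]
  have memVF : ∀ B : PBond (F.P n) 0 → Matrix (Fin 2) (Fin 2) ℂ, toL2B F n cB B ∈ VF ↔ ∀ c, (B c).trace = 0 := fun B => by
    change (∀ c, ((toL2B F n cB).symm (toL2B F n cB B) c).trace = 0) ↔ _
    rw [LinearEquiv.symm_apply_apply]
  -- central fields are orthogonal to the traceless sectors, and conversely
  have scalar_mem_VEc : ∀ z : PBond (F.P K) 0 → ℂ, toL2 F K c₀ (fun b => z b • (1 : Matrix (Fin 2) (Fin 2) ℂ)) ∈ VEᗮ := by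
    intro z
    rw [Submodule.mem_orthogonal]
    intro v hv
    obtain ⟨A, rfl⟩ : ∃ A, v = toL2 F K c₀ A := ⟨(toL2 F K c₀).symm v, ((toL2 F K c₀).apply_symm_apply v).symm⟩
    rw [inner_toL2]
    exact mul_eq_zero_of_right _ (Finset.sum_eq_zero fun b _ => trace_conjTranspose_mul_smul_one ((memVE A).1 hv b) (z b))
  have scalar_mem_VFc : ∀ d : PBond (F.P n) 0 → ℂ, toL2B F n cB (fun c => d c • (1 : Matrix (Fin 2) (Fin 2) ℂ)) ∈ VFᗮ := by
    intro d
    rw [Submodule.mem_orthogonal]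
    intro v hv
    obtain ⟨B, rfl⟩ : ∃ B, v = toL2B F n cB B := ⟨(toL2B F n cB).symm v, ((toL2B F n cB).apply_symm_apply v).symm⟩
    rw [inner_toL2B]
    exact mul_eq_zero_of_right _ (Finset.sum_eq_zero fun c _ => trace_conjTranspose_mul_smul_one ((memVF B).1 hv c) (d c))
  have exists_scalar_of_mem_VEc : ∀ u ∈ VEᗮ, ∃ c : PBond (F.P K) 0 → ℂ, u = toL2 F K c₀ (fun b => c b • (1 : Matrix (Fin 2) (Fin 2) ℂ)) := by
    intro u hu
    obtain ⟨A, rfl⟩ : ∃ A, u = toL2 F K c₀ A := ⟨(toL2 F K c₀).symm u, ((toL2 F K c₀).apply_symm_apply u).symm⟩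
    have hpt : ∀ b, ∃ c : ℂ, A b = c • (1 : Matrix (Fin 2) (Fin 2) ℂ) := by
      intro b
      refine exists_smul_one_of_trace_orthogonal (A b) fun X hX => ?_
      have hmem : toL2 F K c₀ (Pi.single b X) ∈ VE := (memVE _).2 fun b' => by
        by_cases hb : b' = b
        · subst hb; rw [Pi.single_eq_same]; exact hX
        · rw [Pi.single_eq_of_ne hb, Matrix.trace_zero]
      have h0 := (Submodule.mem_orthogonal _ _).1 hu _ hmem
      rw [inner_toL2, Finset.sum_eq_single b (fun b' _ hb' => by rw [Pi.single_eq_of_ne hb', Matrix.conjTranspose_zero, Matrix.zero_mul, Matrix.trace_zero])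
        (fun hb => (hb (Finset.mem_univ b)).elim), Pi.single_eq_same] at h0
      have hc₀ : ((c₀ : ℝ) : ℂ) ≠ 0 := Complex.ofReal_ne_zero.2 (ne_of_gt (Fact.out : 0 < c₀))
      exact (mul_eq_zero.1 h0).resolve_left hc₀
    choose c hc using hpt
    exact ⟨c, congrArg _ (funext hc)⟩
  have exists_scalar_of_mem_VSc : ∀ u ∈ VSᗮ, ∃ c : Site (F.P K) 0 → ℂ, u = toL2S F K c₀ (fun x => c x • (1 : Matrix (Fin 2) (Fin 2) ℂ)) := by
    intro u hu
    obtain ⟨l, rfl⟩ : ∃ l, u = toL2S F K c₀ l := ⟨(toL2S F K c₀).symm u, ((toL2S F K c₀).apply_symm_apply u).symm⟩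
    have hpt : ∀ x, ∃ c : ℂ, l x = c • (1 : Matrix (Fin 2) (Fin 2) ℂ) := by
      intro x
      refine exists_smul_one_of_trace_orthogonal (l x) fun X hX => ?_
      have hmem : toL2S F K c₀ (Pi.single x X) ∈ VS := fun x' => by
        rw [LinearEquiv.symm_apply_apply]
        by_cases hx : x' = x
        · subst hx; rw [Pi.single_eq_same]; exact hX
        · rw [Pi.single_eq_of_ne hx, Matrix.trace_zero]
      have h0 := (Submodule.mem_orthogonal _ _).1 hu _ hmem
      rw [inner_toL2S, Finset.sum_eq_single x (fun x' _ hx' => by rw [Pi.single_eq_of_ne hx', Matrix.conjTranspose_zero, Matrix.zero_mul, Matrix.trace_zero])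
        (fun hx => (hx (Finset.mem_univ x)).elim), Pi.single_eq_same] at h0
      have hc₀ : ((c₀ : ℝ) : ℂ) ≠ 0 := Complex.ofReal_ne_zero.2 (ne_of_gt (Fact.out : 0 < c₀))
      exact (mul_eq_zero.1 h0).resolve_left hc₀
    choose c hc using hpt
    exact ⟨c, congrArg _ (funext hc)⟩
  -- the data respect sector and complement
  have hD_V : ∀ g ∈ VS, DL2 F n K c₀ U₀ g ∈ VE := by
    intro g hg
    obtain ⟨l, rfl⟩ : ∃ l, g = toL2S F K c₀ l := ⟨(toL2S F K c₀).symm g, ((toL2S F K c₀).apply_symm_apply g).symm⟩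
    have hl : ∀ x, (l x).trace = 0 := fun x => by have := hg x; rwa [LinearEquiv.symm_apply_apply] at this
    exact fun b' => trace_DL2_apply_eq_zero U₀ l hl b'
  have hDstar_V : ∀ f ∈ VE, LinearMap.adjoint (DL2 F n K c₀ U₀) f ∈ VS := by
    intro f hf
    obtain ⟨A, rfl⟩ : ∃ A, f = toL2 F K c₀ A := ⟨(toL2 F K c₀).symm f, ((toL2 F K c₀).apply_symm_apply f).symm⟩
    rw [adjoint_DL2]
    exact fun x => trace_DstarL2_apply_eq_zero F n K c₀ U₀ A ((memVE A).1 hf) x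
  have hD_Vc : ∀ u ∈ VSᗮ, DL2 F n K c₀ U₀ u ∈ VEᗮ := fun u hu => mapsTo_orthogonal_of_adjoint _ VS VE hDstar_V hu
  have hQ_V : ∀ f ∈ VE, QL2 F n K h c₀ cB U₀ f ∈ VF := by
    intro f hf
    obtain ⟨A, rfl⟩ : ∃ A, f = toL2 F K c₀ A := ⟨(toL2 F K c₀).symm f, ((toL2 F K c₀).apply_symm_apply f).symm⟩
    rw [QL2_toL2]
    exact (memVF _).2 (hQtr A ((memVE A).1 hf))
  have hQ_Vc : ∀ u ∈ VEᗮ, QL2 F n K h c₀ cB U₀ u ∈ VFᗮ := by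
    intro u hu
    obtain ⟨c, rfl⟩ := exists_scalar_of_mem_VEc u hu
    obtain ⟨d, hd⟩ := hQsc c
    rw [QL2_toL2, hd]
    exact scalar_mem_VFc d
  -- the reflections intertwined by the data
  have hDρ : ∀ s, DL2 F n K c₀ U₀ (VS.reflection s) = VE.reflection (DL2 F n K c₀ U₀ s) := reflection_comm_of_mapsTo VS VE _ hD_V hD_Vc
  have hQρ : ∀ x, QL2 F n K h c₀ cB U₀ (VE.reflection x) = VF.reflection (QL2 F n K h c₀ cB U₀ x) := reflection_comm_of_mapsTo VE VF _ hQ_V hQ_Vc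
  have hkindρ : ((∀ x y : BondL2K ℂ 3 (periodsT3 F K) c₀ W₂, ⟪VE.reflection x, VE.reflection y⟫_ℂ = ⟪y, x⟫_ℂ) ∧
      (∀ x y : SiteL2K ℂ 3 (periodsT3 F K) c₀ W₂, ⟪VS.reflection x, VS.reflection y⟫_ℂ = ⟪y, x⟫_ℂ) ∧
      (∀ x y : WL2 ℂ (fun _ : PBond (F.P n) 0 => cB) W₂, ⟪VF.reflection x, VF.reflection y⟫_ℂ = ⟪y, x⟫_ℂ)) ∨
    ((∀ x y : BondL2K ℂ 3 (periodsT3 F K) c₀ W₂, ⟪VE.reflection x, VE.reflection y⟫_ℂ = ⟪x, y⟫_ℂ) ∧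
      (∀ x y : SiteL2K ℂ 3 (periodsT3 F K) c₀ W₂, ⟪VS.reflection x, VS.reflection y⟫_ℂ = ⟪x, y⟫_ℂ) ∧
      (∀ x y : WL2 ℂ (fun _ : PBond (F.P n) 0 => cB) W₂, ⟪VF.reflection x, VF.reflection y⟫_ℂ = ⟪x, y⟫_ℂ)) :=
    Or.inr ⟨fun x y => VE.reflection.inner_map_map x y, fun x y => VS.reflection.inner_map_map x y, fun x y => VF.reflection.inner_map_map x y⟩
  have hDsρ : ∀ x, DstarL2 F n K c₀ U₀ (VE.reflection x) = VS.reflection (DstarL2 F n K c₀ U₀ x) :=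
    DstarL2_comm' F n K c₀ cB U₀ (fun x => VE.reflection x) (fun s => VS.reflection s) (fun y => VF.reflection y) hkindρ
      (fun x => VE.reflection_reflection x) (fun s => VS.reflection_reflection s) hDρ
  have hRSρ : ∀ s, RS F n K h c₀ cB U₀ (VS.reflection s) = VS.reflection (RS F n K h c₀ cB U₀ s) :=
    RS_comm F n K h c₀ cB U₀ (fun x => VE.reflection x) (fun s => VS.reflection s) (fun y => VF.reflection y) hkindρ
      (fun x y => map_add _ x y) (fun x y => map_add _ x y) (fun x => VE.reflection_reflection x) (fun s => VS.reflection_reflection s) hDρ hQρ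
  ------------------------------------------------------------------
  -- the readback `RSPi ∘ DstarPi = toL2S⁻¹ ∘ R_S ∘ D* ∘ toL2`
  ------------------------------------------------------------------
  have hLdef : ∀ Y : PBond (F.P K) 0 → Matrix (Fin 2) (Fin 2) ℂ,
      RSPi F n K h c₀ cB U₀ (DstarPi F n K c₀ U₀ Y) = (toL2S F K c₀).symm (RS F n K h c₀ cB U₀ (DstarL2 F n K c₀ U₀ (toL2 F K c₀ Y))) := fun Y => by
    rw [RSPi_apply, DstarPi_apply, LinearEquiv.apply_symm_apply]
  refine ⟨fun Y hY x => ?_, fun Y hY x => ?_⟩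
  · ----------------------------------------------------------------
    -- (a) the `𝔰𝔲(2)` sector
    ----------------------------------------------------------------
    -- skew-Hermitian: `Y` is anti-fixed by the conjugation, hence so is `R_S D* Y`
    have hfc : cE (toL2 F K c₀ Y) = -toL2 F K c₀ Y := by
      have hfun : star ((toL2 F K c₀).symm (toL2 F K c₀ Y)) = -(toL2 F K c₀).symm (toL2 F K c₀ Y) := funext fun b => by
        rw [LinearEquiv.symm_apply_apply, Pi.star_apply, Pi.neg_apply, (hY b).1]
      show toL2 F K c₀ (star ((toL2 F K c₀).symm (toL2 F K c₀ Y))) = -toL2 F K c₀ Y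
      rw [hfun, map_neg, LinearEquiv.apply_symm_apply]
    have hgc : cS (RS F n K h c₀ cB U₀ (DstarL2 F n K c₀ U₀ (toL2 F K c₀ Y))) = -RS F n K h c₀ cB U₀ (DstarL2 F n K c₀ U₀ (toL2 F K c₀ Y)) := by
      rw [← hRSc, ← hDsc, hfc, map_neg, map_neg]
    -- traceless: `Y ∈ V_E`, `D*(V_E) ⊆ V_S`, `R_S(V_S) ⊆ V_S` (fixed by the reflection)
    have hfV : toL2 F K c₀ Y ∈ VE := (memVE Y).2 fun b => (hY b).2
    have hDsfV : DstarL2 F n K c₀ U₀ (toL2 F K c₀ Y) ∈ VS := by rw [← adjoint_DL2]; exact hDstar_V _ hfV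
    have hgV : RS F n K h c₀ cB U₀ (DstarL2 F n K c₀ U₀ (toL2 F K c₀ Y)) ∈ VS := by
      rw [← Submodule.reflection_eq_self_iff, ← hRSρ, Submodule.reflection_mem_subspace_eq_self hDsfV]
    rw [hLdef]
    refine ⟨?_, hgV x⟩
    have hfun := congrArg (toL2S F K c₀).symm hgc
    rw [LinearEquiv.symm_apply_apply, map_neg] at hfun
    have hx := congrFun hfun x
    rw [Pi.star_apply, Pi.neg_apply] at hx
    exact hx
  · ----------------------------------------------------------------
    -- (b) the scalar sector
    ----------------------------------------------------------------
    choose z hz using hY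
    have hYeq : Y = fun b => z b • (1 : Matrix (Fin 2) (Fin 2) ℂ) := funext hz
    have hfVc : toL2 F K c₀ Y ∈ VEᗮ := by rw [hYeq]; exact scalar_mem_VEc z
    -- `D*(V_Eᗮ) ⊆ V_Sᗮ` through the adjoint `D** = D`
    have hDsfVc : DstarL2 F n K c₀ U₀ (toL2 F K c₀ Y) ∈ VSᗮ :=
      mapsTo_orthogonal_of_adjoint (DstarL2 F n K c₀ U₀) VE VS (fun v hv => by rw [← adjoint_DL2, LinearMap.adjoint_adjoint]; exact hD_V v hv) hfVc
    -- `R_S(V_Sᗮ) ⊆ V_Sᗮ` (anti-fixed by the reflection)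
    have hgVc : RS F n K h c₀ cB U₀ (DstarL2 F n K c₀ U₀ (toL2 F K c₀ Y)) ∈ VSᗮ := by
      have hneg : VS.reflection (DstarL2 F n K c₀ U₀ (toL2 F K c₀ Y)) = -DstarL2 F n K c₀ U₀ (toL2 F K c₀ Y) :=
        Submodule.reflection_mem_subspace_orthogonalComplement_eq_neg hDsfVc
      have h1 : VS.reflection (RS F n K h c₀ cB U₀ (DstarL2 F n K c₀ U₀ (toL2 F K c₀ Y))) = -RS F n K h c₀ cB U₀ (DstarL2 F n K c₀ U₀ (toL2 F K c₀ Y)) := by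
        rw [← hRSρ, hneg, map_neg]
      have h2 : VSᗮ.reflection (RS F n K h c₀ cB U₀ (DstarL2 F n K c₀ U₀ (toL2 F K c₀ Y))) = RS F n K h c₀ cB U₀ (DstarL2 F n K c₀ U₀ (toL2 F K c₀ Y)) := by
        rw [Submodule.reflection_orthogonal_apply, h1, neg_neg]
      exact (Submodule.reflection_eq_self_iff _).1 h2
    obtain ⟨c, hc⟩ := exists_scalar_of_mem_VSc _ hgVc
    refine ⟨c x, ?_⟩
    rw [hLdef, hc, LinearEquiv.symm_apply_apply]

/-- **`hLsu` — THE RESTRICTED LANDAU DIVERGENCE MAPS `𝔰𝔲(2)`-VALUED VECTOR FIELDS TO `𝔰𝔲(2)`-VALUED GAUGE PARAMETERS** (part (a) of ★★`RSPi_DstarPi_sectors`, the row shape of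
✓`Prop7LandauTransversalityMargin.hcore_su2_of_pairing` verbatim). [cite: Balaban1985BackgroundPropagators, (3.8) p.392, p.393, (3.20)–(3.23) p.394; Balaban1985Variational, (51) p.286] -/
theorem RSPi_DstarPi_su2 (U₀ : GaugeField (F.P K) 0 (Matrix.specialUnitaryGroup (Fin 2) ℂ))
    (hQ : ∀ A : PBond (F.P K) 0 → Matrix (Fin 2) (Fin 2) ℂ, QTwS F n K h U₀ (star A) = star (QTwS F n K h U₀ A))
    (hQtr : ∀ A : PBond (F.P K) 0 → Matrix (Fin 2) (Fin 2) ℂ, (∀ b, (A b).trace = 0) → ∀ c, (QTwS F n K h U₀ A c).trace = 0)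
    (hQsc : ∀ c : PBond (F.P K) 0 → ℂ, ∃ d : PBond (F.P n) 0 → ℂ, QTwS F n K h U₀ (fun b => c b • (1 : Matrix (Fin 2) (Fin 2) ℂ)) = fun c' => d c' • 1) :
    ∀ Y : PBond (F.P K) 0 → Matrix (Fin 2) (Fin 2) ℂ, (∀ b, star (Y b) = -Y b ∧ (Y b).trace = 0) →
      ∀ x, star (RSPi F n K h c₀ cB U₀ (DstarPi F n K c₀ U₀ Y) x) = -RSPi F n K h c₀ cB U₀ (DstarPi F n K c₀ U₀ Y) x ∧
        (RSPi F n K h c₀ cB U₀ (DstarPi F n K c₀ U₀ Y) x).trace = 0 :=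
  (RSPi_DstarPi_sectors F h U₀ hQ hQtr hQsc).1

/-- **`hLsc` — THE RESTRICTED LANDAU DIVERGENCE MAPS CENTRAL VECTOR FIELDS TO CENTRAL GAUGE PARAMETERS** (part (b) of ★★`RSPi_DstarPi_sectors`, the row shape verbatim).
[cite: Balaban1985BackgroundPropagators, (3.8) p.392, p.393, (3.20)–(3.23) p.394; Balaban1985Variational, (51) p.286] -/
theorem RSPi_DstarPi_central (U₀ : GaugeField (F.P K) 0 (Matrix.specialUnitaryGroup (Fin 2) ℂ))
    (hQ : ∀ A : PBond (F.P K) 0 → Matrix (Fin 2) (Fin 2) ℂ, QTwS F n K h U₀ (star A) = star (QTwS F n K h U₀ A))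
    (hQtr : ∀ A : PBond (F.P K) 0 → Matrix (Fin 2) (Fin 2) ℂ, (∀ b, (A b).trace = 0) → ∀ c, (QTwS F n K h U₀ A c).trace = 0)
    (hQsc : ∀ c : PBond (F.P K) 0 → ℂ, ∃ d : PBond (F.P n) 0 → ℂ, QTwS F n K h U₀ (fun b => c b • (1 : Matrix (Fin 2) (Fin 2) ℂ)) = fun c' => d c' • 1) :
    ∀ Y : PBond (F.P K) 0 → Matrix (Fin 2) (Fin 2) ℂ, (∀ b, ∃ z : ℂ, Y b = z • (1 : Matrix (Fin 2) (Fin 2) ℂ)) →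
      ∀ x, ∃ z : ℂ, RSPi F n K h c₀ cB U₀ (DstarPi F n K c₀ U₀ Y) x = z • (1 : Matrix (Fin 2) (Fin 2) ℂ) :=
  (RSPi_DstarPi_sectors F h U₀ hQ hQtr hQsc).2

/-- ★ **`hLsu` AT `U₀ ∈ 𝔘_k(ε₀)` IN THE WINDOWS `10⁹L²e ≤ 1`, `10¹²L³ε₀ ≤ 1`** — the `QTwS` rows BY NAME (✓`QTwS_star_comm_of_regPr`, ✓`QTwS_traceless_of_regPr`, ✓`QTwS_scalar_of_regPr`):
no displayed row. [cite: Balaban1985BackgroundPropagators, (3.8) p.392, p.393, (3.20)–(3.23) p.394; Balaban1985Variational, (51) p.286, (82)–(83) p.290] -/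
theorem RSPi_DstarPi_su2_of_regPr [Fact (0 < (F.L : ℝ))] [Fact (0 < ((F.L : ℝ)⁻¹) ^ (K - n))]
    {ε₀ e : ℝ} (hε₀ : 0 < ε₀) (he : 0 < e) (hWe : 10 ^ 9 * (F.L : ℝ) ^ 2 * e ≤ 1) (hWε : 10 ^ 12 * (F.L : ℝ) ^ 3 * ε₀ ≤ 1)
    (U₀ : GaugeField (F.P K) 0 (Matrix.specialUnitaryGroup (Fin 2) ℂ)) (hreg : RegPr F n K ε₀ U₀) :
    ∀ Y : PBond (F.P K) 0 → Matrix (Fin 2) (Fin 2) ℂ, (∀ b, star (Y b) = -Y b ∧ (Y b).trace = 0) →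
      ∀ x, star (RSPi F n K h c₀ cB U₀ (DstarPi F n K c₀ U₀ Y) x) = -RSPi F n K h c₀ cB U₀ (DstarPi F n K c₀ U₀ Y) x ∧
        (RSPi F n K h c₀ cB U₀ (DstarPi F n K c₀ U₀ Y) x).trace = 0 :=
  RSPi_DstarPi_su2 F h U₀ (QTwS_star_comm_of_regPr F h hε₀ he hWe hWε U₀ hreg) (QTwS_traceless_of_regPr F h hε₀ he hWe hWε U₀ hreg)
    (QTwS_scalar_of_regPr F h hε₀ hWε U₀ hreg)

/-- ★ **`hLsc` AT `U₀ ∈ 𝔘_k(ε₀)` IN THE WINDOWS `10⁹L²e ≤ 1`, `10¹²L³ε₀ ≤ 1`** — the `QTwS` rows BY NAME: no displayed row.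
[cite: Balaban1985BackgroundPropagators, (3.8) p.392, p.393, (3.20)–(3.23) p.394; Balaban1985Variational, (51) p.286, (82)–(83) p.290] -/
theorem RSPi_DstarPi_central_of_regPr [Fact (0 < (F.L : ℝ))] [Fact (0 < ((F.L : ℝ)⁻¹) ^ (K - n))]
    {ε₀ e : ℝ} (hε₀ : 0 < ε₀) (he : 0 < e) (hWe : 10 ^ 9 * (F.L : ℝ) ^ 2 * e ≤ 1) (hWε : 10 ^ 12 * (F.L : ℝ) ^ 3 * ε₀ ≤ 1)
    (U₀ : GaugeField (F.P K) 0 (Matrix.specialUnitaryGroup (Fin 2) ℂ)) (hreg : RegPr F n K ε₀ U₀) :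
    ∀ Y : PBond (F.P K) 0 → Matrix (Fin 2) (Fin 2) ℂ, (∀ b, ∃ z : ℂ, Y b = z • (1 : Matrix (Fin 2) (Fin 2) ℂ)) →
      ∀ x, ∃ z : ℂ, RSPi F n K h c₀ cB U₀ (DstarPi F n K c₀ U₀ Y) x = z • (1 : Matrix (Fin 2) (Fin 2) ℂ) :=
  RSPi_DstarPi_central F h U₀ (QTwS_star_comm_of_regPr F h hε₀ he hWe hWε U₀ hreg) (QTwS_traceless_of_regPr F h hε₀ he hWe hWε U₀ hreg)
    (QTwS_scalar_of_regPr F h hε₀ hWε U₀ hreg)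

/-! ## §2 The `𝔰𝔲(2)` sector of the covariant Laplacian `Δ^η_{U₀} = D*_{U₀}D_{U₀}` -/

omit [Fact (0 < cB)] in
/-- ★ **`hΔsu` — `Δ^η_{U₀}` MAPS `𝔰𝔲(2)`-VALUED GAUGE PARAMETERS TO `𝔰𝔲(2)`-VALUED GAUGE PARAMETERS** (any background `U₀`; no averaging row): skew-Hermitian by ✓`covLapSite_star_comm`,
traceless by the stencils of `D_{U₀}` (✓`trace_DL2_apply_eq_zero`) and `D*_{U₀}` (✓`trace_DstarL2_apply_eq_zero`). [cite: Balaban1985BackgroundPropagators, (3.3) p.391, (3.8) p.392, (3.23) p.394, p.393; Balaban1985Variational, (51) p.286] -/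
theorem covLapSite_su2 (U₀ : GaugeField (F.P K) 0 (Matrix.specialUnitaryGroup (Fin 2) ℂ))
    (l : Site (F.P K) 0 → Matrix (Fin 2) (Fin 2) ℂ) (hl : ∀ x, star (l x) = -l x ∧ (l x).trace = 0) (x : Site (F.P K) 0) :
    star ((toL2S F K c₀).symm (covLapSite F n K c₀ U₀ (toL2S F K c₀ l)) x) = -(toL2S F K c₀).symm (covLapSite F n K c₀ U₀ (toL2S F K c₀ l)) x ∧
      ((toL2S F K c₀).symm (covLapSite F n K c₀ U₀ (toL2S F K c₀ l)) x).trace = 0 := by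
  refine ⟨?_, ?_⟩
  · -- skew-Hermitian: `Δ^η` commutes with the conjugation and `l` is anti-fixed
    have hlc : toL2S F K c₀ (star ((toL2S F K c₀).symm (toL2S F K c₀ l))) = -toL2S F K c₀ l := by
      have hfun : star l = -l := funext fun y => by rw [Pi.star_apply, Pi.neg_apply, (hl y).1]
      rw [LinearEquiv.symm_apply_apply, hfun, map_neg]
    have hc := covLapSite_star_comm (n := n) U₀ (toL2S F K c₀ l)
    rw [hlc, map_neg] at hc
    have hfun := congrArg (toL2S F K c₀).symm hc
    rw [map_neg, LinearEquiv.symm_apply_apply] at hfun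
    have hx := congrFun hfun x
    rw [Pi.neg_apply, Pi.star_apply] at hx
    exact hx.symm
  · -- traceless: `Δ^η = D* ∘ D`, both stencils preserve the traceless sector
    have hΔ : covLapSite F n K c₀ U₀ (toL2S F K c₀ l) = DstarL2 F n K c₀ U₀ (DL2 F n K c₀ U₀ (toL2S F K c₀ l)) := rfl
    have hD : ∀ b, ((toL2 F K c₀).symm (DL2 F n K c₀ U₀ (toL2S F K c₀ l)) b).trace = 0 := fun b => trace_DL2_apply_eq_zero U₀ l (fun y => (hl y).2) b
    have h1 := trace_DstarL2_apply_eq_zero F n K c₀ U₀ ((toL2 F K c₀).symm (DL2 F n K c₀ U₀ (toL2S F K c₀ l))) hD x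
    rw [LinearEquiv.apply_symm_apply] at h1
    rw [hΔ]
    exact h1

end Summit.QuantumFields.YangMills.Theorems.Prop7LandauDivergenceSectors

end
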